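import Literature.NumberTheory.PAdicHodge.AinfWeierstrassSupersingularTorsion
import Literature.NumberTheory.PAdicHodge.AinfWeierstrassEtaPeriodHom
import Literature.NumberTheory.PAdicHodge.BdRPlusLatticeSeparated
import Literature.NumberTheory.EllipticCurves.SupersingularFormalMulFrobenius
import Literature.NumberTheory.EllipticCurves.HasseInvariantTraceProofs
import HarnessLib

/-!
# Non-vanishing of the ω-period: `∫_τ ω ≠ 0` as soon as `u₁ = τ₁ ∉ p𝒪_{ℂ_F}` (supersingular reduction, `p ≥ 5`)

Topic `Literature/NumberTheory/PAdicHodge`; namespace `Literature.NumberTheory.PAdicHodge.AinfTop`. THEOREMS ONLY (no definition,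
no named fact, no instance, no `sorry`).

The witness (N1) of the `p`-adic period road to "`V_pE` is de Rham at supersingular reduction" (Fontaine 1982 §5, Colmez 1992 §2;
BSD route EdixhovenFibreFiveSeven, crux K★, hDR|ss): for an integral Weierstrass equation `W/ℤ`, a prime `p ≥ 5` with `p ∤ Δ_W` and
`A_p(W mod p) = 0`, and a Tate-module point `τ = (uₙ) ∈ T_pŴ(𝒪_{ℂ_F})`,

  **`u₁ ∉ p𝒪_{ℂ_F} ⟹ ∫_τ ω ≠ 0`** (`omegaPeriodHom_ne_zero_of_seq_one_not_mem`),

in two steps: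
* (L1) `omegaPeriod = 0 ⟹ [τ] = 0` (`torsionLift_eq_zero_of_omegaPeriod_eq_zero`): `∫_τ ω = log_W([τ])` and
  `log_W(X) = X·(1 + O(X))`, so `log_W(x) = x · (unit of the local ring B_dR⁺)` for `x ∈ Fil¹`; and `𝔸_inf → B_dR⁺` is injective
  (`𝔸_inf ∩ Fil^k = ξ^k𝔸_inf`, `ξ`-adic separatedness).
* (L2) `[τ] = 0 ⟹ u₁ ∈ p𝒪_{ℂ_F}` (`theta_mem_span_of_mulP_eq_zero`): `[τ] = [p]_W(T₁)` for Fontaine's element `T₁` of the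
  shifted sequence (`θ(T₁) = u₁`); at supersingular reduction `[p] = p·R + X^{p²}·S` with `S(0) = [X^{p²}][p] ≡ −1 (mod p)`
  (`p ≥ 5`: `a_p = 0`, exact height `2`, tree `coeff_sq_formalMul_ringChar_of_tr_eq_zero`), and `S(T₁)` is a unit of `𝔸_inf`
  (`T₁` is topologically nilpotent, hence in the Jacobson radical of the `(p, ξ)`-complete ring `𝔸_inf`); so `[p](T₁) = 0` forces
  `T₁^{p²} ∈ p𝔸_inf`, hence `T₁ ∈ p𝔸_inf = ker(𝕎(𝒪♭) → 𝒪♭)` (`𝒪♭` is reduced), hence `u₁ = θ(T₁) ∈ p𝒪_{ℂ_F}`.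
Combined with the point witness of `AinfWeierstrassSupersingularTorsion` (`‖p‖ < ‖u₁‖^p`, so `u₁ ∉ p𝒪_{ℂ_F}`) this yields
`exists_omegaPeriodHom_ne_zero`. BSD is not proved by any of this.

## References
* [Fontaine1982FormesDifferentielles] J.-M. Fontaine, Invent. Math. 65 (1982), §5.
* [Colmez1992PeriodesAbeliennes] P. Colmez, Math. Ann. 292 (1992), §2.
* [FontaineAsterisque223III] J.-M. Fontaine, Astérisque 223 (1994), Exp. II §1.2–1.5.
* [SilvermanAEC2009] J. H. Silverman, *The Arithmetic of Elliptic Curves*, IV.5–IV.7.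
-/

noncomputable section

open PowerSeries

namespace Literature.NumberTheory.PAdicHodge

open Literature Literature.NumberTheory.GaloisRepresentations Literature.NumberTheory.EllipticCurves WeierstrassCurve
open Literature.NumberTheory.GaloisRepresentations.IsNonarchimedeanLocalField Literature.NumberTheory.GaloisRepresentations.LubinTate

namespace AinfTop

variable {F : Type} [Field F] [ValuativeRel F] [TopologicalSpace F] [IsNonarchimedeanLocalField F] [CharZero F]
  {p : ℕ} [Fact p.Prime] [Fact (¬ IsUnit (p : integerC F))] [IsAdicComplete (Ideal.span {(p : integerC F)}) (integerC F)]
  {hθ : Function.Surjective (WittVector.fontaineTheta (integerC F) p)} (W : WeierstrassCurve ℤ)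

/-! ## §1 (L1): `log_W` has no zeros on `Fil¹ B_dR⁺` other than `0` -/

/-- `1 + y` is a unit of `B_dR⁺` for `y ∈ Fil¹ = ξB_dR⁺` (the maximal ideal of the local ring `B_dR⁺`).
[cite: FontaineAsterisque223III, Exp. II §1.5.2] -/
theorem isUnit_one_add_of_mem_filOne (hF : Function.Surjective (WittVector.fontaineTheta (integerC F) p)) {y : BdRPlusTop F p}
    (hy : y ∈ (BdRPlusTop.filOne F p).toIdeal) : IsUnit (1 + y) := by
  haveI := isLocalRing_bDeRhamPlus (F := F) (p := p) hF
  have hy' : (BdRPlusTop.of F p).symm y ∈ IsLocalRing.maximalIdeal (BDeRhamPlus (integerC F) p) := by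
    rw [maximalIdeal_bDeRhamPlus_eq_span hF]; exact hy
  have h1 : IsUnit ((BdRPlusTop.of F p).symm (1 + y)) := by
    rw [map_add, map_one]
    by_contra hnu
    have hmem : 1 + (BdRPlusTop.of F p).symm y ∈ IsLocalRing.maximalIdeal (BDeRhamPlus (integerC F) p) :=
      (IsLocalRing.mem_maximalIdeal _).2 (mem_nonunits_iff.2 hnu)
    have hone : (1 : BDeRhamPlus (integerC F) p) ∈ IsLocalRing.maximalIdeal (BDeRhamPlus (integerC F) p) := by
      have h := Ideal.sub_mem _ hmem hy'
      rwa [add_sub_cancel_right] at h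
    exact (IsLocalRing.maximalIdeal.isMaximal _).ne_top (Ideal.eq_top_of_isUnit_mem _ hone isUnit_one)
  simpa using h1.map (BdRPlusTop.of F p)

/-- `evalAt x X = x` on `Fil¹ B_dR⁺`. [cite: FontaineAsterisque223III, Exp. II §1.5.4] -/
theorem evalAt_filOne_X (x : (BdRPlusTop.filOne F p).toIdeal) :
    evalAt (BdRPlusTop.filOne F p) x (X : PowerSeries RatCoeff) = (x : BdRPlusTop F p) := by
  rw [← coe_evalPt₁_eq_evalAt (BdRPlusTop.filOne F p) PowerSeries.X PowerSeries.constantCoeff_X x]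
  exact congrArg Subtype.val (evalPt_X (BdRPlusTop.filOne F p) () (fun _ => x))

/-- **`𝔸_inf → B_dR⁺` is injective** (`𝔸_inf ∩ Fil^k = ξ^k 𝔸_inf` for all `k`, and `𝔸_inf` is `ξ`-adically separated).
[cite: FontaineAsterisque223III, Exp. II §1.5.3] -/
theorem eq_zero_of_ofAinf_eq_zero {a : Ainf (p := p) F} (h : BdRPlusTop.ofAinf F p a = 0) : a = 0 := by
  haveI := isAdicComplete_span_xi (F := F) (p := p)
  refine IsHausdorff.haus (IsAdicComplete.toIsHausdorff (I := Ideal.span {(xi : Ainf (p := p) F)})) a fun n => ?_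
  rw [SModEq.sub_mem, sub_zero, smul_eq_mul, Ideal.mul_top, Ideal.span_singleton_pow]
  exact BdRPlusTop.mem_span_xi_pow_of_ofAinf_mem (by rw [h]; exact zero_mem _)

/-- **(L1) `∫_τ ω = 0 ⟹ [τ] = 0`**: `∫_τ ω = log_W([τ])` with `log_W(X) = X·(1 + X·G₁(X))`, and `1 + x G₁(x)` is a unit of
`B_dR⁺` for `x = [τ] ∈ Fil¹`; so `log_W([τ]) = 0` forces `[τ] = 0` in `B_dR⁺`, hence in `𝔸_inf`.
[cite: Fontaine1982FormesDifferentielles, §5] [cite: SilvermanAEC2009, IV.5.5] -/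
theorem torsionLift_eq_zero_of_omegaPeriod_eq_zero {t : ℕ → (maxNilIdealC F).toIdeal} (ht0 : (t 0 : CBall F) = 0)
    (htp : ∀ n, mulPC F p W (t (n + 1)) = t n) (h : omegaPeriod W hθ t ht0 htp = 0) :
    torsionLift W hθ t htp = 0 := by
  -- `log_W = X · (1 + X · G₁)`
  obtain ⟨G, hG⟩ := PowerSeries.X_dvd_iff.mpr (constantCoeff_logSeries W)
  have hG0 : constantCoeff G = 1 := by
    have h1 : coeff 1 (logSeries W) = 1 := by
      rw [logSeries, PowerSeries.coeff_map, WeierstrassCurve.coeff_one_formalLog, map_one]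
    rw [hG, PowerSeries.coeff_succ_X_mul, coeff_zero_eq_constantCoeff] at h1
    exact h1
  obtain ⟨G₁, hG₁⟩ := PowerSeries.X_dvd_iff.mpr (show constantCoeff (G - 1) = 0 by rw [map_sub, hG0, map_one, sub_self])
  have hlog : logSeries W = X * (1 + X * G₁) := by rw [← hG₁, add_sub_cancel, hG]
  set x := torsionLiftFil W hθ t ht0 htp with hxdef
  -- evaluate
  have heval : omegaPeriod W hθ t ht0 htp =
      (x : BdRPlusTop F p) * (1 + evalAt (BdRPlusTop.filOne F p) x (X * G₁)) := by
    rw [omegaPeriod, coe_evalPt₁_eq_evalAt, hlog, map_mul, map_add, map_one, evalAt_filOne_X]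
  have hmem : evalAt (BdRPlusTop.filOne F p) x (X * G₁) ∈ (BdRPlusTop.filOne F p).toIdeal := by
    rw [← coe_evalPt₁_eq_evalAt (BdRPlusTop.filOne F p) (X * G₁) (by rw [map_mul, constantCoeff_X, zero_mul]) x]
    exact (evalPt₁ (BdRPlusTop.filOne F p) (X * G₁) _ x).2
  have hunit := isUnit_one_add_of_mem_filOne hθ hmem
  have hx0 : (x : BdRPlusTop F p) = 0 := by
    rw [h] at heval
    exact hunit.mul_left_eq_zero.1 heval.symm
  rw [hxdef, coe_torsionLiftFil] at hx0
  have h2 := eq_zero_of_ofAinf_eq_zero hx0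
  rw [RingEquiv.map_eq_zero_iff] at h2
  exact h2

/-! ## §2 (L2): `[p]_W T = 0` in `Ŵ(𝔫)` forces `θ(T) ∈ p𝒪_{ℂ_F}` (supersingular, `p ≥ 5`) -/

omit [CharZero F] [Fact (¬ IsUnit (p : integerC F))] [IsAdicComplete (Ideal.span {(p : integerC F)}) (integerC F)] in
/-- At an odd prime `p ≥ 5` of good supersingular reduction, **`[X^{p²}][p]_W ≡ −1 (mod p)`** (`a_p = 0` for `p ≥ 5`, exact height
`2`: tree `coeff_sq_formalMul_ringChar_of_tr_eq_zero`). [cite: SilvermanAEC2009, IV.7.5 and Ex. V.5.10] [cite: Serre1972, §1.11] -/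
theorem prime_dvd_coeff_sq_formalMul_add_one (hp5 : 5 ≤ p) (hΔ : ¬ (p : ℤ) ∣ W.Δ)
    (hA : (W.map (Int.castRingHom (ZMod p))).hasseCoeff p = 0) : (p : ℤ) ∣ coeff (p ^ 2) (W.formalMul p) + 1 := by
  have hp : p.Prime := Fact.out
  have hp2 : p ≠ 2 := by omega
  haveI : (W.map (Int.castRingHom (ZMod p))).IsElliptic := ⟨by
    rw [WeierstrassCurve.map_Δ, isUnit_iff_ne_zero, eq_intCast, Ne, ZMod.intCast_zmod_eq_zero_iff_dvd]
    exact hΔ⟩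
  have htr := HasseManin.tr_eq_zero_of_dvd_of_five_le (W.map (Int.castRingHom (ZMod p))) (ZMod.card p) hp5
    (((W.map (Int.castRingHom (ZMod p))).hasseCoeff_eq_zero_iff_dvd_tr hp2).1 hA)
  have h := (W.map (Int.castRingHom (ZMod p))).coeff_sq_formalMul_ringChar_of_tr_eq_zero htr
  rw [← WeierstrassCurve.map_formalMul, PowerSeries.coeff_map, eq_intCast, ← sub_eq_zero, sub_neg_eq_add] at h
  exact (ZMod.intCast_zmod_eq_zero_iff_dvd _ p).1 (by exact_mod_cast h)

/-- `evalAt a X = a` on `𝔫 ⊂ 𝔸_inf`. [cite: FontaineAsterisque223III, Exp. II §1.2.2] -/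
theorem evalAt_nilTheta_X (a : (nilTheta F p hθ).toIdeal) : evalAt (nilTheta F p hθ) a (X : ℤ⟦X⟧) = (a : AinfTop F p) := by
  rw [← coe_evalPt₁_eq_evalAt (nilTheta F p hθ) PowerSeries.X PowerSeries.constantCoeff_X a]
  exact congrArg Subtype.val (evalPt_X (nilTheta F p hθ) () (fun _ => a))

/-- `evalAt a (C z) = z` on `𝔫 ⊂ 𝔸_inf`. [cite: FontaineAsterisque223III, Exp. II §1.2.2] -/
theorem evalAt_nilTheta_C (a : (nilTheta F p hθ).toIdeal) (z : ℤ) : evalAt (nilTheta F p hθ) a (C z) = (z : AinfTop F p) := by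
  rw [show (C z : ℤ⟦X⟧) = algebraMap ℤ ℤ⟦X⟧ z from rfl, AlgHom.commutes, algebraMap_int_eq, eq_intCast]

/-- An element of `𝔫 = θ⁻¹(𝔪_{ℂ_F})` lies in the Jacobson radical of `𝔸_inf` (some power lies in `(p, ξ)`, and `𝔸_inf` is
`(p, ξ)`-adically complete). [cite: FontaineAsterisque223III, Exp. II §1.3] -/
theorem mem_jacobson_bot_of_mem_nilTheta {a : AinfTop F p} (ha : a ∈ (nilTheta F p hθ).toIdeal) :
    a ∈ (⊥ : Ideal (AinfTop F p)).jacobson := by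
  haveI : IsAdicComplete (WithIdeal.i : Ideal (AinfTop F p)) (AinfTop F p) := isAdicComplete_span_p_xi (F := F) (p := p)
  have hJ : (WithIdeal.i : Ideal (AinfTop F p)) ≤ (⊥ : Ideal (AinfTop F p)).jacobson := IsAdicComplete.le_jacobson_bot _
  obtain ⟨N, hN⟩ := exists_pow_mem_span_p_xi_of_norm_lt_one hθ (a := (of F p).symm a) ha
  have hrad : a ∈ (WithIdeal.i : Ideal (AinfTop F p)).radical := ⟨N, hN⟩
  have h1 := Ideal.radical_le_jacobson hrad
  rw [← Ideal.jacobson_idem (I := (⊥ : Ideal (AinfTop F p)))]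
  exact Ideal.jacobson_mono hJ h1

/-- **(L2) `[p]_W T = 0`, `T ∈ 𝔫` ⟹ `θ(T) ∈ p𝒪_{ℂ_F}`** at good supersingular reduction, `p ≥ 5`: write `[p] = p·R + X^{p²}·S` with
`S(0) ≡ −1 (mod p)`; `S(T)` is a unit of `𝔸_inf` (`T` and `p` lie in the Jacobson radical), so `T^{p²} ∈ p𝔸_inf`; as
`𝔸_inf/p = 𝒪♭` is reduced (`𝕎`: `x ∈ p𝕎 ⟺ x₀ = 0`), `T ∈ p𝔸_inf` and `θ(T) ∈ p𝒪_{ℂ_F}`.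
[cite: FontaineAsterisque223III, Exp. II §1.2–1.3] [cite: SilvermanAEC2009, IV.7.5] -/
theorem theta_mem_span_of_mulP_eq_zero (hp5 : 5 ≤ p) (hΔ : ¬ (p : ℤ) ∣ W.Δ)
    (hA : (W.map (Int.castRingHom (ZMod p))).hasseCoeff p = 0) (a : (nilTheta F p hθ).toIdeal)
    (h : (mulP W a : AinfTop F p) = 0) : theta F p (a : AinfTop F p) ∈ Ideal.span {(p : CBall F)} := by
  have hp : p.Prime := Fact.out
  have hp2 : p ≠ 2 := by omega
  obtain ⟨R, S, hRS, -, -, hS0⟩ := exists_formalMul_prime_eq_of_hasseCoeff_eq_zero W hp2 hA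
  -- `S = c + X·S₁`, `c ≡ -1 (mod p)` a unit of `𝔸_inf`
  set c : ℤ := coeff (p ^ 2) (W.formalMul p) with hc
  obtain ⟨m, hm⟩ := prime_dvd_coeff_sq_formalMul_add_one W hp5 hΔ hA
  obtain ⟨S₁, hS₁⟩ := PowerSeries.X_dvd_iff.mpr (show PowerSeries.constantCoeff (S - C c) = 0 by
    rw [map_sub, hS0, PowerSeries.constantCoeff_C, sub_self])
  have hS : S = C c + X * S₁ := by rw [← hS₁, add_sub_cancel]
  haveI : IsAdicComplete (WithIdeal.i : Ideal (AinfTop F p)) (AinfTop F p) := isAdicComplete_span_p_xi (F := F) (p := p)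
  have hpJ : (p : AinfTop F p) ∈ (⊥ : Ideal (AinfTop F p)).jacobson :=
    IsAdicComplete.le_jacobson_bot (WithIdeal.i : Ideal (AinfTop F p))
      (by rw [ideal_eq]; exact Ideal.subset_span (Set.mem_insert _ _))
  have hcu : IsUnit ((c : ℤ) : AinfTop F p) := by
    have h1 : IsUnit ((p : AinfTop F p) * (-(m : AinfTop F p)) + 1) := Ideal.mem_jacobson_bot.1 hpJ _
    have h2 : ((c : ℤ) : AinfTop F p) = -((p : AinfTop F p) * (-(m : AinfTop F p)) + 1) := by
      have h3 : (c : ℤ) = p * m - 1 := by linarith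
      rw [h3]; push_cast; ring
    rw [h2]; exact h1.neg
  -- evaluate `[p]` at `a`
  have haJ : (a : AinfTop F p) ∈ (⊥ : Ideal (AinfTop F p)).jacobson := mem_jacobson_bot_of_mem_nilTheta a.2
  have heval : (mulP W a : AinfTop F p) = (p : AinfTop F p) * evalAt (nilTheta F p hθ) a R +
      (a : AinfTop F p) ^ (p ^ 2) * ((c : AinfTop F p) + (a : AinfTop F p) * evalAt (nilTheta F p hθ) a S₁) := by
    rw [mulP, coe_evalPt₁_eq_evalAt, hRS, hS, map_add, map_mul, map_mul, map_add, map_mul, map_pow, evalAt_nilTheta_X,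
      evalAt_nilTheta_C, evalAt_nilTheta_C, Int.cast_natCast]
  have hu : IsUnit ((c : AinfTop F p) + (a : AinfTop F p) * evalAt (nilTheta F p hθ) a S₁) := by
    obtain ⟨cu, hcu'⟩ := hcu
    have h1 : IsUnit ((a : AinfTop F p) * (evalAt (nilTheta F p hθ) a S₁ * ↑cu⁻¹) + 1) := Ideal.mem_jacobson_bot.1 haJ _
    have h2 : (c : AinfTop F p) + (a : AinfTop F p) * evalAt (nilTheta F p hθ) a S₁ =
        (cu : AinfTop F p) * ((a : AinfTop F p) * (evalAt (nilTheta F p hθ) a S₁ * ↑cu⁻¹) + 1) := by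
      rw [show (cu : AinfTop F p) * ((a : AinfTop F p) * (evalAt (nilTheta F p hθ) a S₁ * ↑cu⁻¹) + 1) =
        (a : AinfTop F p) * evalAt (nilTheta F p hθ) a S₁ * ((cu : AinfTop F p) * ↑cu⁻¹) + cu by ring,
        Units.mul_inv, mul_one, hcu', add_comm]
    rw [h2]; exact (Units.isUnit cu).mul h1
  -- `a^{p²} ∈ p𝔸_inf`
  have hpow : (a : AinfTop F p) ^ (p ^ 2) ∈ Ideal.span {(p : AinfTop F p)} := by
    obtain ⟨v, hv⟩ := hu
    rw [h, ← hv] at heval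
    have h3 : (a : AinfTop F p) ^ (p ^ 2) = -((p : AinfTop F p) * evalAt (nilTheta F p hθ) a R) * ↑v⁻¹ := by
      rw [Units.eq_mul_inv_iff_mul_eq]
      exact eq_neg_of_add_eq_zero_right heval.symm
    rw [h3, neg_mul, mul_assoc]
    exact Submodule.neg_mem _ (Ideal.mul_mem_right _ _ (Ideal.mem_span_singleton_self _))
  -- `𝔸_inf / p = 𝒪♭` is reduced: `a ∈ p𝔸_inf`
  have hmem : (of F p).symm (a : AinfTop F p) ∈ Ideal.span {(p : Ainf (p := p) F)} := by
    rw [WittVector.mem_span_p_iff_coeff_zero_eq_zero]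
    have h1 : (of F p).symm ((a : AinfTop F p) ^ (p ^ 2)) ∈ Ideal.span {(p : Ainf (p := p) F)} := by
      obtain ⟨b, hb⟩ := Ideal.mem_span_singleton'.1 hpow
      exact Ideal.mem_span_singleton'.2 ⟨(of F p).symm b, by rw [← hb, map_mul, map_natCast]⟩
    rw [WittVector.mem_span_p_iff_coeff_zero_eq_zero, map_pow, ← WittVector.constantCoeff_apply, map_pow,
      WittVector.constantCoeff_apply] at h1
    exact pow_eq_zero_iff (pow_ne_zero 2 hp.ne_zero) |>.1 h1
  obtain ⟨b, hb⟩ := Ideal.mem_span_singleton'.1 hmem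
  refine Ideal.mem_span_singleton'.2 ⟨theta F p (of F p b), ?_⟩
  have h1 : (a : AinfTop F p) = of F p b * (p : AinfTop F p) := by
    have h2 := congrArg (of F p) hb
    rw [map_mul, map_natCast, RingEquiv.apply_symm_apply] at h2
    exact h2.symm
  rw [h1, map_mul, map_natCast]

/-! ## §3 (N1): `u₁ ∉ p𝒪_{ℂ_F} ⟹ ∫_τ ω ≠ 0`, and the witness -/

/-- **(N1) `u₁ ∉ p𝒪_{ℂ_F} ⟹ ∫_τ ω ≠ 0`** for `τ = (uₙ) ∈ T_pŴ(𝒪_{ℂ_F})` at good supersingular reduction (`p ≥ 5`): if `∫_τ ω = 0`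
then `[τ] = 0` (L1), `[τ] = [p]_W T₁` with `θ(T₁) = u₁` (tree `mulP_torsionLiftShiftPt`, `theta_torsionLiftShift`), so `u₁ ∈ p𝒪_{ℂ_F}`
(L2). [cite: Fontaine1982FormesDifferentielles, §5] [cite: Colmez1992PeriodesAbeliennes, §2] -/
theorem omegaPeriodHom_ne_zero_of_seq_one_not_mem (hp5 : 5 ≤ p) (hΔ : ¬ (p : ℤ) ∣ W.Δ)
    (hA : (W.map (Int.castRingHom (ZMod p))).hasseCoeff p = 0) (τ : TatePt F p W)
    (h₁ : ((seq W τ 1 : (maxNilIdealC F).toIdeal) : CBall F) ∉ Ideal.span {(p : CBall F)}) :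
    omegaPeriodHom W hθ τ ≠ 0 := by
  intro h0
  apply h₁
  rw [omegaPeriodHom_apply] at h0
  have h1 := torsionLift_eq_zero_of_omegaPeriod_eq_zero W (seq_zero W τ) (mulPC_seq W τ) h0
  have h2 : (mulP W (torsionLiftShiftPt W hθ (seq W τ) (mulPC_seq W τ) 1) : AinfTop F p) = 0 := by
    rw [mulP_torsionLiftShiftPt, torsionLiftShift_zero, h1]
  have h3 := theta_mem_span_of_mulP_eq_zero W hp5 hΔ hA _ h2
  rwa [coe_torsionLiftShiftPt, theta_torsionLiftShift] at h3

omit [CharZero F] [Fact (¬ IsUnit (p : integerC F))] [IsAdicComplete (Ideal.span {(p : integerC F)}) (integerC F)] in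
/-- `‖p‖ < ‖u‖^p` (with `‖u‖ ≤ 1`) excludes `u ∈ p𝒪_{ℂ_F}` (`‖u‖^p ≤ ‖u‖ ≤ ‖p‖` otherwise). [cite: Tate1967, §4] -/
theorem not_mem_span_of_norm_p_lt_norm_pow (u : CBall F)
    (hpu : ‖(p : CompletedAlgClosure F)‖ < ‖(u : CompletedAlgClosure F)‖ ^ p) : u ∉ Ideal.span {(p : CBall F)} := by
  intro hu
  obtain ⟨b, hb⟩ := Ideal.mem_span_singleton'.1 hu
  have hu1 : ‖(u : CompletedAlgClosure F)‖ ≤ 1 := NumberTheory.EllipticCurves.norm_coe_unitBall_le_one u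
  have hb1 : ‖(b : CompletedAlgClosure F)‖ ≤ 1 := NumberTheory.EllipticCurves.norm_coe_unitBall_le_one b
  have h1 : ‖(u : CompletedAlgClosure F)‖ ≤ ‖(p : CompletedAlgClosure F)‖ := by
    rw [← hb, Subring.coe_mul, norm_mul, Subring.coe_natCast]
    exact mul_le_of_le_one_left (norm_nonneg _) hb1
  have h2 : ‖(u : CompletedAlgClosure F)‖ ^ p ≤ ‖(u : CompletedAlgClosure F)‖ := by
    calc ‖(u : CompletedAlgClosure F)‖ ^ p ≤ ‖(u : CompletedAlgClosure F)‖ ^ 1 :=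
          pow_le_pow_of_le_one (norm_nonneg _) hu1 (Fact.out : p.Prime).pos
      _ = _ := pow_one _
  exact absurd (hpu.trans_le (h2.trans h1)) (lt_irrefl _)

/-- **The ω-period is not identically zero**: at a prime `p ≥ 5` of good supersingular reduction of `W/ℤ`, for every `p`-adic
field `F` some `τ ∈ T_pŴ(𝒪_{ℂ_F})` has `∫_τ ω ≠ 0` (witness: any `τ` with `τ₁ ≠ 0`, whose `u₁` has `‖p‖ < ‖u₁‖^p`).
[cite: Fontaine1982FormesDifferentielles, §5] [cite: Tate1967, §4] -/
theorem exists_omegaPeriodHom_ne_zero (hp5 : 5 ≤ p) (hΔ : ¬ (p : ℤ) ∣ W.Δ)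
    (hA : (W.map (Int.castRingHom (ZMod p))).hasseCoeff p = 0) : ∃ τ : TatePt F p W, omegaPeriodHom W hθ τ ≠ 0 := by
  have hp2 : p ≠ 2 := by omega
  obtain ⟨τ, -, hτ⟩ := exists_tatePt_norm_p_lt_norm_pow F p W hp2 hΔ hA
  exact ⟨τ, omegaPeriodHom_ne_zero_of_seq_one_not_mem W hp5 hΔ hA τ (not_mem_span_of_norm_p_lt_norm_pow _ hτ)⟩

end AinfTop

end Literature.NumberTheory.PAdicHodge

end
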